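import Summits.CriticalPhenomena.PercolationContinuityZ3.Theorems.PercNearOneGluingAdditiveGluingBhkTwoAny
import HarnessLib

/-! # Crux `PercNearOneGluing.AdditiveGluing` (stmt-CriticalPhenomena-4576), line `starglue/tieline`
— stub `stub_crossAnyTwoOne_c7` (BHK Thm. 1.4, two relays `s, t` against the third relay `x`)

Helper file for the crux skeleton of the line `starglue/tieline` (lead
prover-line-stmt-CriticalPhenomena-4576-c7-0): proves exactly the registered stub signature
`stub_crossAnyTwoOne_c7`; lands with `--supports stmt-CriticalPhenomena-4576`.

## Content

Finite weighted graph on `Fin n` (`μ = prodBernoulli w` on `BondConfig (Fin n)`, events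
`{x ↔ y} = openConn x y`), three relays `s, t, x` with `s ≠ x`, `t ≠ x`, points `o, b`, and the
decreasing separation event `D' := {s ↮ x} ∩ {t ↮ x}`.  Then

`μ(D') · μ(D' ∩ ({s ↔ o} ∪ {t ↔ o}) ∩ {x ↔ b}) ≤ μ(D' ∩ ({s ↔ o} ∪ {t ↔ o})) · μ(D' ∩ {x ↔ b})`.

This is the literal specialisation of the landed two-set lemma `stub_bhkTwoAny_c7`
(file `…AdditiveGluingBhkTwoAny`, van den Berg–Häggström–Kahn (2006) Thm. 1.4 for the clusters of
two disjoint vertex sets `S, S'` given `{S ↮ S'}`) to `S := {s, t}`, `S' := {x}` (disjoint since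
`s ≠ x`, `t ≠ x`; `s = t` is allowed), after the set identities
`{ω | ∀ s' ∈ {s,t}, ∀ x' ∈ {x}, s' ↮ x'} = {s ↮ x} ∩ {t ↮ x}`,
`⋃_{s' ∈ {s,t}} {s' ↔ o} = {s ↔ o} ∪ {t ↔ o}`, `⋃_{s' ∈ {x}} {s' ↔ b} = {x ↔ b}`.
-/

namespace Summit.CriticalPhenomena.PercolationContinuityZ3.Theorems

open MeasureTheory Set Literature.Probability.LatticeModels Literature.Probability.Percolation

noncomputable section
open Classical

/-- **BHK 2006 Thm. 1.4, two relays against one:** for `s ≠ x`, `t ≠ x` and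
`D' = {s ↮ x} ∩ {t ↮ x}`,
`μ(D') μ(D' ∩ ({s ↔ o} ∪ {t ↔ o}) ∩ {x ↔ b}) ≤ μ(D' ∩ ({s ↔ o} ∪ {t ↔ o})) μ(D' ∩ {x ↔ b})`
— the specialisation `S = {s, t}`, `S' = {x}` of the landed `stub_bhkTwoAny_c7` (increasing
`1{o ∈ C_S}` and increasing `1{b ∈ C_{S'}}` are negatively correlated given `{S ↮ S'}`).
[cite: VandenbergHaggstromKahn2005, Thm. 1.4 (p. 7)] -/
theorem stub_crossAnyTwoOne_c7 : ∀ (n : ℕ) (w : Sym2 (Fin n) → unitInterval) (s t x o b : Fin n), s ≠ x → t ≠ x → (prodBernoulli w).real ((openConn s x)ᶜ ∩ (openConn t x)ᶜ) * (prodBernoulli w).real ((openConn s x)ᶜ ∩ (openConn t x)ᶜ ∩ ((openConn s o ∪ openConn t o) ∩ openConn x b)) ≤ (prodBernoulli w).real ((openConn s x)ᶜ ∩ (openConn t x)ᶜ ∩ (openConn s o ∪ openConn t o)) * (prodBernoulli w).real ((openConn s x)ᶜ ∩ (openConn t x)ᶜ ∩ openConn x b) := by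
  intro n w s t x o b hsx htx
  have hdisj : Disjoint ({s, t} : Finset (Fin n)) ({x} : Finset (Fin n)) := by
    rw [Finset.disjoint_singleton_right]
    simp only [Finset.mem_insert, Finset.mem_singleton, not_or]
    exact ⟨fun h => hsx h.symm, fun h => htx h.symm⟩
  have hD : {ω : BondConfig (Fin n) | ∀ s' ∈ ({s, t} : Finset (Fin n)), ∀ x' ∈ ({x} : Finset (Fin n)),
      ¬ (openGraph ω).Reachable s' x'} = (openConn s x)ᶜ ∩ (openConn t x)ᶜ := by
    ext ω
    simp only [Finset.mem_insert, Finset.mem_singleton, forall_eq_or_imp, forall_eq, mem_setOf_eq,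
      mem_inter_iff, mem_compl_iff, openConn]
  have hS : (⋃ s' ∈ ({s, t} : Finset (Fin n)), (openConn s' o : Set (BondConfig (Fin n)))) =
      openConn s o ∪ openConn t o := by
    rw [Finset.set_biUnion_insert, Finset.set_biUnion_singleton]
  have hS' : (⋃ s' ∈ ({x} : Finset (Fin n)), (openConn s' b : Set (BondConfig (Fin n)))) =
      openConn x b := by
    rw [Finset.set_biUnion_singleton]
  have key := stub_bhkTwoAny_c7 n w {s, t} {x} o b hdisj
  rw [hD, hS, hS'] at key
  exact key

end

end Summit.CriticalPhenomena.PercolationContinuityZ3.Theorems
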